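import Summits.QuantumFields.YangMills.Theorems.BalabanLadderNTStrongCouplingLongTubeDefs
import Summits.QuantumFields.YangMills.Theorems.BalabanLadderNTStrongCouplingLongTubeClass
import HarnessLib

/-!
# Crux `NT` (stmt-QuantumFields-19353), strong-coupling rungs: the LONG TUBE CLASSIFICATION at EVERY length —
# closed JOINED families of at most `4n + 2` plaquettes through a plaquette at time `c` and one based at time `c - n`

Helper file of the fleet lead prover of crux `NT` (unit `ym-spine-19353-p1`, g27), part IV of the length-generic tube
toolkit: the combinatorial input (H1′) of the free pair jet at every time separation.  The tree has `n = 2`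
(`ClosedFamilies.eq_tube_of_closed`, budget 10) and `n = 4` (`ClosedFamilies.eq_longTube_of_closed`, budget 18); the
g26 hand proof of the latter is organised here as an induction over the slabs:

* `level_sub_one` — level arithmetic `z + k e₀ - e₀ = z + (k-1) e₀`;
* **`eq_longTube_of_closed_general`** — a CLOSED family `F` of at most `4n + 2` plaquettes (`n ≥ 1`) containing `(x; a)` and
  a plaquette based at time `x 0 - n`, some bond of `(x; a)` JOINED to some bond of it through `F`, satisfies `0 < a₁` and
  `F = longTube (x - n e₀) n a`.  Slab crossing along the chain (`exists_temporal_of_chain`) occupies the `n` slabs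
  below `x`, four members each (`four_le_card_slab_of_closed`); an extra occupied slab would cost `4n + 4`
  (`four_mul_card_le_card`); counting `4n + 1 + 1 ≤ 4n + 2` the family is the `n` slabs, `(x; a)` and ONE non-temporal member
  at the bottom; the top slab is the four sides under the square (`far_cases`, `mem_sides_of_far_mem`), each lower slab the
  translate of the one above (`far_cases`, `mem_four_of_add_mem`), and the bottom member holds two parallel near bonds of
  the lowest sides (`near_cases`, `eq_of_two_ilinks`).

HONEST FRAMING: lattice combinatorics only; nothing about measures, `β`, NT or the gap. [folklore]
-/

/-! ## Part IV — the LONG TUBE CLASSIFICATION at every length: closed + joined + `≤ 4n + 2` members ⇒ the tube -/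

namespace Summit.QuantumFields.YangMills.Cruxes.NT.StrongCouplingRung.LongTube

open Finset
open Literature.Probability.LatticeModels (Site)
open Literature.MathematicalPhysics.QuantumLattice (ZdEdge ZdPlaquette plaquetteEdges)
open Literature.MathematicalPhysics.QuantumFieldTheory (IsParallel LinkAdj mk_mem_plaquetteEdges_iff eq_of_two_ilinks
  four_mul_card_le_card)
open Summit.QuantumFields.YangMills.Cruxes.NT.StrongCouplingRung.ClosedFamilies

/-- One level down: `z + k e₀ - e₀ = z + (k-1) e₀` (`k ≥ 1`). [folklore] -/
theorem level_sub_one (z : Site 4) {k : ℕ} (hk : 1 ≤ k) :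
    z + Pi.single 0 (k : ℤ) - Pi.single 0 1 = z + Pi.single (0 : Fin 4) ((k - 1 : ℕ) : ℤ) := by
  ext i
  by_cases hi : i = 0
  · subst hi
    simp
    omega
  · simp [Pi.single_eq_of_ne hi]

/-- **Long tube classification, every length.**  A CLOSED family `F` (no private bond) of at most `4n + 2` plaquettes
of `ℤ⁴` (`n ≥ 1`) containing a plaquette `(x; a)` and a plaquette `pl` based at time `x 0 - n`, some bond of `(x; a)`
being JOINED to some bond of `pl` through `F`, is the `(4n+2)`-face boundary of the `n × 1 × 1` box under the square of
`(x; a)`: `a` is not temporal and `F = longTube (x - n e₀) n a` (bottom cap `(x - n e₀; a) = pl`'s slab, `4n` temporal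
sides, top cap `(x; a)`).  Proof: slab crossing along the bond chain occupies the `n` slabs below `x`, four members
each (`four_le_card_slab_of_closed`); an `(n+1)`-st occupied slab would cost `4n + 4`; so `(x; a)` is not temporal and,
counting `4n + 1 + 1`, the family is the `n` slabs, `(x; a)` and ONE non-temporal member at the bottom; top down, each
slab is the four sides over the square (`far_cases`, `mem_sides_of_far_mem`, `mem_four_of_add_mem`), and the bottom
member contains two parallel near bonds of the lowest sides (`eq_of_two_ilinks`).  The case `n = 4` is
`ClosedFamilies.eq_longTube_of_closed`, `n = 2` is `ClosedFamilies.eq_tube_of_closed`. [folklore] -/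
theorem eq_longTube_of_closed_general {F : Finset (ZdPlaquette 4)}
    (hN : ∀ p ∈ F, ∀ ℓ ∈ plaquetteEdges p, ∃ p' ∈ F, p' ≠ p ∧ ℓ ∈ plaquetteEdges p')
    {n : ℕ} (hn : 1 ≤ n) (hcard : F.card ≤ 4 * n + 2)
    {x : Site 4} {a : {q : Fin 4 × Fin 4 // q.1 < q.2}} (hx : ((x, a) : ZdPlaquette 4) ∈ F)
    {pl : ZdPlaquette 4} (hpl : pl ∈ F) (hplc : pl.1 0 = x 0 - n)
    (hJ : ∃ e₁ ∈ plaquetteEdges ((x, a) : ZdPlaquette 4), ∃ e₂ ∈ plaquetteEdges pl,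
      Relation.ReflTransGen (LinkAdj F) e₁ e₂) :
    ∃ ha : (0 : Fin 4) < a.1.1, F = longTube (x - Pi.single 0 (n : ℤ)) n a ha := by
  obtain ⟨⟨a₁, a₂⟩, h₁₂⟩ := a
  obtain ⟨e₁, he₁, e₂, he₂, hchain⟩ := hJ
  set z : Site 4 := x - Pi.single 0 (n : ℤ) with hz
  have hz0 : z 0 = x 0 - n := by simp [hz]
  have hxz : x = z + Pi.single 0 (n : ℤ) := by simp [hz]
  have he₁0 : x 0 ≤ e₁.1 0 := by
    rcases apply_zero_of_mem_plaquetteEdges he₁ with h | ⟨-, h⟩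
    · exact le_of_eq h.symm
    · simp only at h
      omega
  -- Step 1: the slabs at the levels `z 0 + k`, `k < n`, are occupied (slab crossing along the chain)
  have hocc : ∀ k, k < n → ∃ p ∈ F, IsParallel p 0 ∧ p.1 0 = z 0 + k := by
    intro k hk
    by_cases hpar : IsParallel pl 0 ∧ k = 0
    · exact ⟨pl, hpl, hpar.1, by rw [hz0, hplc, hpar.2]; simp⟩
    · refine exists_temporal_of_chain hchain _ (by omega) ?_
      rcases apply_zero_of_mem_plaquetteEdges he₂ with h | ⟨hj, h⟩
      · rw [h, hplc, hz0]
        omega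
      · have hk0 : k ≠ 0 := fun hk0 => hpar ⟨(isParallel_zero_iff pl).2 hj, hk0⟩
        rw [h, hplc, hz0]
        omega
  have h4 : ∀ k, k < n → 4 ≤ (F.filter fun p => IsParallel p 0 ∧ p.1 0 = z 0 + k).card :=
    fun k hk => four_le_card_slab_of_closed hN 0 _ (hocc k hk)
  -- Step 2: no other slab is occupied (it would cost `4n + 4` members)
  have hlev : ∀ p ∈ F, IsParallel p 0 → z 0 ≤ p.1 0 ∧ p.1 0 < z 0 + n := by
    intro p hp hpar
    by_contra hout
    have hnot : p.1 0 ∉ (range n).image fun k : ℕ => z 0 + k := by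
      rw [mem_image]
      rintro ⟨k, hk, hk'⟩
      rw [mem_range] at hk
      omega
    have hTcard : (insert (p.1 0) ((range n).image fun k : ℕ => z 0 + k)).card = n + 1 := by
      rw [card_insert_of_notMem hnot, card_image_of_injective _ (fun k k' h => by simpa using h), card_range]
    have := four_mul_card_le_card F 0 (insert (p.1 0) ((range n).image fun k : ℕ => z 0 + k)) (by
      intro t ht
      rw [mem_insert, mem_image] at ht
      rcases ht with rfl | ⟨k, hk, rfl⟩
      · exact four_le_card_slab_of_closed hN 0 _ ⟨p, hp, hpar, rfl⟩
      · exact h4 k (mem_range.1 hk))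
    omega
  -- Step 3: the cap `(x; a)` is not temporal
  have hxa : ¬ IsParallel ((x, ⟨(a₁, a₂), h₁₂⟩) : ZdPlaquette 4) 0 := fun h => by
    have := (hlev _ hx h).2
    simp only at this
    omega
  have ha : (0 : Fin 4) < a₁ := by
    rw [isParallel_zero_iff] at hxa
    exact Fin.pos_of_ne_zero hxa
  refine ⟨ha, ?_⟩
  -- Step 4: the pieces and the count `4n + 1 + 1 ≤ 4n + 2`
  set Tk : ℕ → Finset (ZdPlaquette 4) := fun k => F.filter fun p => IsParallel p 0 ∧ p.1 0 = z 0 + k with hTk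
  set S0 := F.filter (fun p => ¬ IsParallel p 0 ∧ p.1 0 = x 0) with hS0
  set Sn := F.filter (fun p => ¬ IsParallel p 0 ∧ p.1 0 = z 0) with hSn
  have hxS0 : ((x, ⟨(a₁, a₂), h₁₂⟩) : ZdPlaquette 4) ∈ S0 := mem_filter.2 ⟨hx, hxa, rfl⟩
  have hSnne : Sn.Nonempty := by
    obtain ⟨p, hp, hpar, hpc⟩ := hocc 0 (by omega)
    obtain ⟨y, ⟨⟨j, m⟩, hjm⟩⟩ := p
    rw [isParallel_zero_iff] at hpar
    simp only at hpar hpc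
    subst hpar
    rcases near_cases hN hp with ⟨q, hq, hqpar, hq0, -⟩ | hq
    · exact ⟨q, mem_filter.2 ⟨hq, hqpar, by rw [hq0, hpc]; simp⟩⟩
    · have := (hlev _ hq (Or.inl rfl)).1
      simp at this hpc
      omega
  have djTT : ∀ k k' : ℕ, k ≠ k' → Disjoint (Tk k) (Tk k') := fun k k' hkk' =>
    disjoint_filter.2 fun p _ h1 h2 => hkk' (by
      have := h1.2.symm.trans h2.2
      omega)
  have djTS0 : ∀ k, Disjoint (Tk k) S0 := fun k => disjoint_filter.2 fun p _ h1 h2 => h2.1 h1.1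
  have djTSn : ∀ k, Disjoint (Tk k) Sn := fun k => disjoint_filter.2 fun p _ h1 h2 => h2.1 h1.1
  have djS : Disjoint S0 Sn := disjoint_filter.2 fun p _ h1 h2 => by
    have := h1.2.symm.trans h2.2
    omega
  set U := (range n).biUnion Tk ∪ S0 ∪ Sn with hU
  have hUF : U ⊆ F := union_subset (union_subset (biUnion_subset.2 fun k _ => filter_subset _ _)
    (filter_subset _ _)) (filter_subset _ _)
  have hcardU : U.card = ∑ k ∈ range n, (Tk k).card + S0.card + Sn.card := by
    rw [hU, card_union_of_disjoint, card_union_of_disjoint, card_biUnion (fun k _ k' _ h => djTT k k' h)]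
    · exact (disjoint_biUnion_left _ _ _).2 fun k _ => djTS0 k
    · rw [disjoint_union_left]
      exact ⟨(disjoint_biUnion_left _ _ _).2 fun k _ => djTSn k, djS⟩
  have hsum : 4 * n ≤ ∑ k ∈ range n, (Tk k).card := by
    calc 4 * n = ∑ _k ∈ range n, 4 := by simp [mul_comm]
      _ ≤ _ := sum_le_sum fun k hk => h4 k (mem_range.1 hk)
  have hS0pos : 0 < S0.card := card_pos.2 ⟨_, hxS0⟩
  have hSnpos : 0 < Sn.card := card_pos.2 hSnne
  have hUle : U.card ≤ 4 * n + 2 := (card_le_card hUF).trans hcard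
  have hFU : U = F := eq_of_subset_of_card_le hUF (by rw [hcardU]; omega)
  have hcards : S0.card = 1 ∧ Sn.card = 1 := by
    rw [hcardU] at hUle
    omega
  -- Step 5: `S0 = {(x; a)}`, `Sn = {qb}`; where the members live
  have hS0eq : S0 = {((x, ⟨(a₁, a₂), h₁₂⟩) : ZdPlaquette 4)} := by
    obtain ⟨w, hw⟩ := card_eq_one.1 hcards.1
    rw [hw] at hxS0 ⊢
    rw [mem_singleton.1 hxS0]
  obtain ⟨qb, hSneq⟩ := card_eq_one.1 hcards.2
  have hqb : qb ∈ Sn := by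
    rw [hSneq]
    exact mem_singleton_self _
  have hmemF : ∀ q ∈ F, (∃ k, k < n ∧ q ∈ Tk k) ∨ q ∈ S0 ∨ q ∈ Sn := by
    intro q hq
    rw [← hFU, hU, mem_union, mem_union, mem_biUnion] at hq
    rcases hq with (⟨k, hk, hqk⟩ | h) | h
    · exact Or.inl ⟨k, mem_range.1 hk, hqk⟩
    · exact Or.inr (Or.inl h)
    · exact Or.inr (Or.inr h)
  have hnonT : ∀ q ∈ F, ¬ IsParallel q 0 → q.1 0 = x 0 ∨ q.1 0 = z 0 := by
    intro q hq hpar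
    rcases hmemF q hq with ⟨k, -, h⟩ | h | h
    · exact absurd (mem_filter.1 h).2.1 hpar
    · exact Or.inl (mem_filter.1 h).2.2
    · exact Or.inr (mem_filter.1 h).2.2
  -- Step 6: the top slab consists of the four sides under the square of `(x; a)` (far bonds)
  have htop : Tk (n - 1) = tubeSides (z + Pi.single 0 ((n - 1 : ℕ) : ℤ)) ⟨(a₁, a₂), h₁₂⟩ ha := by
    have hlvl : z + Pi.single 0 ((n - 1 : ℕ) : ℤ) = x - Pi.single 0 1 := by
      rw [hxz, level_sub_one z hn]
    refine eq_of_subset_of_card_le (fun p hp => ?_)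
      (by unfold tubeSides; exact card_le_four.trans (h4 _ (by omega)))
    obtain ⟨hpF, hpar, hpc⟩ := mem_filter.1 hp
    obtain ⟨y, ⟨⟨j, m⟩, hjm⟩⟩ := p
    rw [isParallel_zero_iff] at hpar
    simp only at hpar hpc
    subst hpar
    rcases far_cases hN hpF with ⟨q, hq, hqpar, hq0, hmem⟩ | hq
    · have hqS0 : q ∈ S0 := mem_filter.2 ⟨hq, hqpar, by rw [hq0, hpc]; omega⟩
      rw [hS0eq, mem_singleton] at hqS0
      subst hqS0
      rw [hlvl]
      exact mem_sides_of_far_mem ha hmem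
    · have := (hlev _ hq (Or.inl rfl)).2
      simp at this
      omega
  -- Step 7: top down, each slab is the translate by `-e₀` of the slab above it (far bonds again)
  have hall : ∀ j, j < n → Tk (n - 1 - j) = tubeSides (z + Pi.single 0 ((n - 1 - j : ℕ) : ℤ)) ⟨(a₁, a₂), h₁₂⟩ ha := by
    intro j
    induction j with
    | zero =>
      intro _
      exact htop
    | succ j ih =>
      intro hj
      have ihj := ih (by omega)
      refine eq_of_subset_of_card_le (fun p hp => ?_)
        (by unfold tubeSides; exact card_le_four.trans (h4 _ (by omega)))
      obtain ⟨hpF, hpar, hpc⟩ := mem_filter.1 hp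
      obtain ⟨y, ⟨⟨j', m⟩, hjm⟩⟩ := p
      rw [isParallel_zero_iff] at hpar
      simp only at hpar hpc
      subst hpar
      rcases far_cases hN hpF with ⟨q, hq, hqpar, hq0, -⟩ | hq
      · exfalso
        rcases hnonT q hq hqpar with h | h
        · rw [h, hpc, hxz] at hq0
          simp at hq0
          omega
        · rw [h, hpc] at hq0
          omega
      · have hqT : ((y + Pi.single 0 1, ⟨(0, m), hjm⟩) : ZdPlaquette 4) ∈ Tk (n - 1 - j) := by
          refine mem_filter.2 ⟨hq, Or.inl rfl, ?_⟩
          show (y + Pi.single 0 1 : Site 4) 0 = z 0 + ((n - 1 - j : ℕ) : ℤ)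
          simp [hpc]
          omega
        rw [ihj] at hqT
        unfold tubeSides at hqT ⊢
        have h4m := mem_four_of_add_mem (Pi.single 0 1) hqT
        have hB : z + Pi.single 0 ((n - 1 - j : ℕ) : ℤ) - Pi.single 0 1 =
            z + Pi.single 0 ((n - 1 - (j + 1) : ℕ) : ℤ) := by
          rw [level_sub_one z (by omega : 1 ≤ n - 1 - j), show n - 1 - j - 1 = n - 1 - (j + 1) by omega]
        simp only [add_sub_right_comm, hB] at h4m
        exact h4m
  have hall' : ∀ k, k < n → Tk k = tubeSides (z + Pi.single 0 (k : ℤ)) ⟨(a₁, a₂), h₁₂⟩ ha := by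
    intro k hk
    have h := hall (n - 1 - k) (by omega)
    rwa [show n - 1 - (n - 1 - k) = k by omega] at h
  -- Step 8: the bottom member contains two parallel near bonds of the lowest sides, so it is the bottom cap
  have hT0 := hall' 0 (by omega)
  simp only [Nat.cast_zero, Pi.single_zero, add_zero] at hT0
  have hnear : ∀ (y : Site 4), ((y, ⟨(0, a₁), ha⟩) : ZdPlaquette 4) ∈ Tk 0 →
      ((y, a₁) : ZdEdge 4) ∈ plaquetteEdges qb := by
    intro y hy
    obtain ⟨hyF, -, hyc⟩ := mem_filter.1 hy
    simp only at hyc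
    rcases near_cases hN hyF with ⟨q, hq, hqpar, hq0, hmem⟩ | hq
    · have hqSn : q ∈ Sn := mem_filter.2 ⟨hq, hqpar, by rw [hq0, hyc]; simp⟩
      rw [hSneq, mem_singleton] at hqSn
      rw [← hqSn]
      exact hmem
    · have := (hlev _ hq (Or.inl rfl)).1
      simp at this hyc
      omega
  have hy₁ : ((z, ⟨(0, a₁), ha⟩) : ZdPlaquette 4) ∈ Tk 0 := by
    rw [hT0]
    exact mem_tubeSides.2 (Or.inl rfl)
  have hy₂ : ((z + Pi.single a₂ 1, ⟨(0, a₁), ha⟩) : ZdPlaquette 4) ∈ Tk 0 := by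
    rw [hT0]
    exact mem_tubeSides.2 (Or.inr (Or.inl rfl))
  have hb₁ : ((z, a₁) : ZdEdge 4) ∈ plaquetteEdges ((z, ⟨(a₁, a₂), h₁₂⟩) : ZdPlaquette 4) := by
    rw [mk_mem_plaquetteEdges_iff]
    exact Or.inl ⟨rfl, Or.inl rfl⟩
  have hb₂ : ((z + Pi.single a₂ 1, a₁) : ZdEdge 4) ∈ plaquetteEdges ((z, ⟨(a₁, a₂), h₁₂⟩) : ZdPlaquette 4) := by
    rw [mk_mem_plaquetteEdges_iff]
    exact Or.inl ⟨rfl, Or.inr rfl⟩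
  have hneq : (z : Site 4) ≠ z + Pi.single a₂ 1 := by
    intro h
    have h' := congrFun h a₂
    simp at h'
  have hcap : ((z, ⟨(a₁, a₂), h₁₂⟩) : ZdPlaquette 4) = qb :=
    eq_of_two_ilinks hneq hb₁ hb₂ (hnear _ hy₁) (hnear _ hy₂)
  -- Step 9: assemble
  ext p
  rw [mem_longTube]
  constructor
  · intro hp
    rcases hmemF p hp with ⟨k, hk, h⟩ | h | h
    · rw [hall' k hk] at h
      exact Or.inr (Or.inr ⟨k, hk, h⟩)
    · rw [hS0eq, mem_singleton] at h
      rw [h, hxz]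
      exact Or.inr (Or.inl rfl)
    · rw [hSneq, mem_singleton] at h
      rw [h, ← hcap]
      exact Or.inl rfl
  · rintro (rfl | rfl | ⟨k, hk, h⟩)
    · rw [hcap]
      exact (mem_filter.1 hqb).1
    · rw [← hxz]
      exact hx
    · rw [← hall' k hk] at h
      exact (mem_filter.1 h).1

end Summit.QuantumFields.YangMills.Cruxes.NT.StrongCouplingRung.LongTube
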